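import Literature.NumberTheory.EllipticCurves.ModularJacobianTorsionHeckeSelfDual
import Literature.NumberTheory.EllipticCurves.ModularJacobianMultiplicityOneCosocleProofs
import HarnessLib

/-!
# `J₀(N)[ℓ]` is Hecke-self-dual — DERIVED from the Hecke-self-adjoint perfect pairing on `H₁(X₀(N), ℤ)`
# (Darmon–Diamond–Taylor 1995, Lemma 1.38 reduced mod `ℓ`; §4.5 p. 134)

Topic `Literature/NumberTheory/EllipticCurves`, the PROOFS companion of `ModularJacobianTorsionHeckeSelfDual.lean`. That file types
ONE named fact, `heckeSelfDual_torsionBy_J0` («`J₀(N)[ℓ] ≅ Hom_{𝔽_ℓ}(J₀(N)[ℓ], 𝔽_ℓ)` as `𝕋`-modules»: a `𝕋_ℤ`-balanced perfect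
`ℤ/ℓ`-valued pairing on `J₀(N)[ℓ]`), and says itself that it is «Lemma 1.38 mod `ℓ`»: the reduction of the `w_N`-twisted
intersection pairing on `Λ = H₁(X₀(N), ℤ)`. The integral pairing is the tree's OTHER named fact
`periodHomology_exists_heckeSelfAdjoint_perfectPairing` (`PeriodHomologyIntersectionPairing.lean`: Merel 1995 §1.2–2.3,
Agashe–Ribet–Stein 2011 §3, Diamond–Im 1995 Rem. 10.2.2). THIS FILE PROVES the reduction:

  `heckeSelfDual_torsionBy_J0_of_perfectPairing : periodHomology_exists_heckeSelfAdjoint_perfectPairing → heckeSelfDual_torsionBy_J0`,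

so that every consumer of the mod-`ℓ` fact (27 files at the time of writing: the BSD cruxes `ThetaLayerLambdaCongruenceAtTwo`,
`SignedMuVanishingAtTwoPlus`, `MazurTateCongruenceAtTwoTop`, …) may replace it by the integral one; the trust base of the mod-`2`
multiplicity-one dictionaries shrinks to {Buzzard 2000 Prop. 2.4, the intersection pairing}. Mechanism (every prime `ℓ`):
`Λ/ℓΛ ≅ J₀(N)[ℓ]` Hecke-equivariantly by `x ↦ [ℓ⁻¹x]` (`J0.exists_linearDivMap`); `B mod ℓ` descends to `Λ/ℓΛ` (balanced because
`B` is self-adjoint); left AND right kernels are trivial because `x ↦ B(x,·)` and — `Λ` being finite free over `ℤ` — `y ↦ B(·,y)`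
are bijections onto `Hom(Λ, ℤ)` (`SocleCosocle.exists_eq_nsmul_of_forall_dvd`, `…_right`). THEOREMS ONLY; nothing is asserted
about the pairing fact itself; BSD is not touched.

References: H. Darmon, F. Diamond, R. Taylor, *Fermat's Last Theorem* (CDM 1995) §1.3 (pp. 27–28), §1.6 Lemma 1.38 (p. 41), §4.5
(p. 134) [DarmonDiamondTaylor1995]; L. Merel, *Homologie des courbes modulaires affines…* (1995) §1.2–1.3, §2.1–2.3
[Merel1995Homologie]; A. Agashe, K. Ribet, W. Stein (2011/12) §3 [AgasheRibetStein2011].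
-/

set_option autoImplicit false

noncomputable section

open scoped MatrixGroups ModularForm

open Module Function CongruenceSubgroup Literature.Algebra.Module

namespace Literature.NumberTheory.EllipticCurves.ModularForms

/-- **`heckeSelfDual_torsionBy_J0` follows from `periodHomology_exists_heckeSelfAdjoint_perfectPairing`** (Darmon–Diamond–Taylor,
Lemma 1.38 reduced mod `ℓ`: «`T_ℓ(J₀(N))/ℓT_ℓ(J₀(N)) ≅ J₀(N)[ℓ] ≅ Hom_{𝔽_ℓ}(J₀(N)[ℓ], 𝔽_ℓ)` as `𝕋_{𝔽_ℓ}`-modules», §4.5 p. 134).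
For every `N ≥ 1` and prime `ℓ`: the `w_N`-twisted intersection pairing `B` on `Λ = H₁(X₀(N), ℤ)` (perfect, Hecke-self-adjoint)
reduces, through the Hecke isomorphism `Λ/ℓΛ ≅ J₀(N)[ℓ]`, `x ↦ [ℓ⁻¹x]`, to a `𝕋_ℤ`-balanced pairing `J₀(N)[ℓ] × J₀(N)[ℓ] → ℤ/ℓ`
with trivial left and right kernels. [cite: DarmonDiamondTaylor1995, §1.6 Lemma 1.38 (p. 41) and §4.5 (p. 134); proved here from the integral pairing] -/
theorem heckeSelfDual_torsionBy_J0_of_perfectPairing (hpair : periodHomology_exists_heckeSelfAdjoint_perfectPairing) :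
    heckeSelfDual_torsionBy_J0 := by
  intro N _ ℓ _
  have hℓ : ℓ ≠ 0 := (Fact.out : ℓ.Prime).ne_zero
  haveI := moduleFinite_int_periodHomologyHecke N
  haveI := moduleFree_int_periodHomologyHecke N
  obtain ⟨B, hB, hadj⟩ := hpair N
  obtain ⟨δ, -, hker, hrange⟩ := J0.exists_linearDivMap N hℓ
  exact SocleCosocle.exists_balanced_perfect_pairing_torsionBy B hB hadj ℓ δ hker hrange

end Literature.NumberTheory.EllipticCurves.ModularForms

end
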